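import Mathlib
import Literature.Geometry.DiscreteGeometry.KissingPatterns

/-!
# Sketch — crux-ideate stmt-AtomisticToContinuum-15799 (`DisclinationRation.FiveFoldRation`), ideator 2, round 1

First lemmas of the idea cards `alexandrov-cone-defect-packing` and `ergodic-flattening`
(they must ELABORATE; proofs are deliberately `sorry`).  The third lemma is the shared front-end
statement (bond symmetry of the alphabet-good shell relation) typed over the crux's own inline
predicate `GA`.
-/

noncomputable section

open MeasureTheory Metric Real

namespace Summit.AtomisticToContinuum.Crystallization.Cruxes.FiveFoldRation.IdeatorTwoSketch

/-- Card `alexandrov-cone-defect-packing`, first lemma (the one new local computation of the line).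
In the spherical suspension `F_ω` of a circle of length `2π - ω` — the link (space of directions) of a
five-fold axis site in the ideal unit tet/oct metric, `ω = ω₅ = 2π - 5·arccos(1/3)` — write a direction
as (latitude `φ ∈ [-π/2, π/2]`, longitude), and let `Δ ∈ [0, π - ω/2]` be the longitude gap of two
directions measured in the short circle; their distance is `arccos (sin φ sin φ' + cos φ cos φ' cos Δ)`.
CLAIM: two directions at distance `> π - ε` hug OPPOSITE poles within `4ε/ω + ε`.  Consequence (card):
the apex line of `ℝ × C_ω` admits no `(2, ε)`-strainer once `2·(4ε/ω + ε) < π/2 - ε`, so by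
Li–Naber (arXiv:1912.03615, Remark 5.1) every axis site lies in the codimension-2 quantitative
singular stratum `S¹_{δ₁, r}` of the ideal metric at EVERY scale `r`. -/
theorem football_nearAntipodal_near_poles (ω ε φ φ' Δ : ℝ) (hω : 0 < ω) (hωπ : ω ≤ π) (hε : 0 < ε)
    (hφ : φ ∈ Set.Icc (-(π / 2)) (π / 2)) (hφ' : φ' ∈ Set.Icc (-(π / 2)) (π / 2))
    (hΔ : Δ ∈ Set.Icc 0 (π - ω / 2))
    (hfar : π - ε < arccos (sin φ * sin φ' + cos φ * cos φ' * cos Δ)) :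
    (π / 2 - φ ≤ 4 * ε / ω + ε ∧ φ' + π / 2 ≤ 4 * ε / ω + ε) ∨
      (π / 2 - φ' ≤ 4 * ε / ω + ε ∧ φ + π / 2 ≤ 4 * ε / ω + ε) := by
  sorry

/-- Cards `ergodic-flattening` and (soft form of) `alexandrov-cone-defect-packing`, first lemma:
Bishop–Gromov volume monotonicity from a `t`-expanding radial retraction — the exact form in which
`CBB(0)` is cashed at an axis site.  `Φ t` moves each point to the parameter-`t` point of a chosen
geodesic from `p`; the `CBB(0)` triangle comparison at `p` is precisely
`t * dist x y ≤ dist (Φ t x) (Φ t y)`.  Conclusion: `r ↦ μH[d](B̄_r(p)) / r^d` is non-increasing.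
Pure Mathlib (`LipschitzOnWith.hausdorffMeasure_image_le` on the inverse of `Φ (r/R)`). -/
theorem hausdorffMeasure_closedBall_mono_of_radialExpansion {X : Type*} [MetricSpace X]
    [MeasurableSpace X] [BorelSpace X] (p : X) (Φ : ℝ → X → X)
    (hcenter : ∀ t : ℝ, 0 ≤ t → t ≤ 1 → ∀ x, dist p (Φ t x) = t * dist p x)
    (hexpand : ∀ t : ℝ, 0 ≤ t → t ≤ 1 → ∀ x y, t * dist x y ≤ dist (Φ t x) (Φ t y))
    (d : ℝ) (hd : 0 ≤ d) (r R : ℝ) (hr : 0 < r) (hrR : r ≤ R) :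
    ENNReal.ofReal ((r / R) ^ d) * μH[d] (closedBall p R) ≤ μH[d] (closedBall p r) := by
  sorry

/-- Shared front end (P1 of both cards; also implicit in line `birth`): the alphabet-good shell
relation is SYMMETRIC and scales of shell-mates agree within `17/20`.  `GA` is the crux's inline
enlarged-alphabet goodness predicate, copied verbatim from
`Summit.AtomisticToContinuum.Crystallization.Theses.DisclinationRation.FiveFoldRation`.
Mechanism: covering radius `≤ 46°` of the three patterns + minimality of `d_y`
(a much smaller shell at `z` would put a neighbour of `z` strictly inside the empty ball of `y`). -/
theorem alphabetGood_shell_symm :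
    let GA : Set (EuclideanSpace ℝ (Fin 3)) → EuclideanSpace ℝ (Fin 3) → Prop := fun S y =>
      let d : ℝ := sInf ((fun z => dist z y) '' (S \ {y}))
      let T : Set (EuclideanSpace ℝ (Fin 3)) :=
        {z : EuclideanSpace ℝ (Fin 3) | z ∈ S ∧ z ≠ y ∧ dist z y < 13 / 10 * d}
      ∃ A : EuclideanSpace ℝ (Fin 3) →ₗᵢ[ℝ] EuclideanSpace ℝ (Fin 3),
        (∃ e : ↥T ≃ ↥Literature.Geometry.DiscreteGeometry.fccKissingPattern, ∀ t : ↥T,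
            dist (d⁻¹ • ((t : EuclideanSpace ℝ (Fin 3)) - y))
              (A ((e t : ↥Literature.Geometry.DiscreteGeometry.fccKissingPattern) :
                EuclideanSpace ℝ (Fin 3))) ≤ 1 / 20) ∨
        (∃ e : ↥T ≃ ↥Literature.Geometry.DiscreteGeometry.hcpKissingPattern, ∀ t : ↥T,
            dist (d⁻¹ • ((t : EuclideanSpace ℝ (Fin 3)) - y))
              (A ((e t : ↥Literature.Geometry.DiscreteGeometry.hcpKissingPattern) :
                EuclideanSpace ℝ (Fin 3))) ≤ 1 / 20) ∨
        (∃ e : ↥T ≃ ↥{p : EuclideanSpace ℝ (Fin 3) | p = !₂[(0 : ℝ), 0, 1] ∨ p = !₂[(0 : ℝ), 0, -1] ∨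
              ∃ k : Fin 5, ∃ σ : ℝ, (σ = 1 / 2 ∨ σ = -(1 / 2)) ∧
                p = !₂[Real.sqrt 3 / 2 * Real.cos (2 * Real.pi * (k : ℝ) / 5),
                      Real.sqrt 3 / 2 * Real.sin (2 * Real.pi * (k : ℝ) / 5), σ]},
          ∀ t : ↥T, dist (d⁻¹ • ((t : EuclideanSpace ℝ (Fin 3)) - y))
            (A ((e t : ↥{p : EuclideanSpace ℝ (Fin 3) | p = !₂[(0 : ℝ), 0, 1] ∨
                p = !₂[(0 : ℝ), 0, -1] ∨ ∃ k : Fin 5, ∃ σ : ℝ, (σ = 1 / 2 ∨ σ = -(1 / 2)) ∧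
                  p = !₂[Real.sqrt 3 / 2 * Real.cos (2 * Real.pi * (k : ℝ) / 5),
                        Real.sqrt 3 / 2 * Real.sin (2 * Real.pi * (k : ℝ) / 5), σ]}) :
              EuclideanSpace ℝ (Fin 3))) ≤ 1 / 20)
    ∀ δ : ℝ, 0 < δ → ∀ S : Set (EuclideanSpace ℝ (Fin 3)),
      (∀ y ∈ S, ∀ z ∈ S, y ≠ z → δ ≤ dist y z) → (∀ y ∈ S, GA S y) →
      ∀ y ∈ S, ∀ z ∈ S, z ≠ y →
        dist z y < 13 / 10 * sInf ((fun w => dist w y) '' (S \ {y})) →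
          17 / 20 * sInf ((fun w => dist w y) '' (S \ {y})) ≤ sInf ((fun w => dist w z) '' (S \ {z})) ∧
          dist y z < 13 / 10 * sInf ((fun w => dist w z) '' (S \ {z})) := by
  sorry

end Summit.AtomisticToContinuum.Crystallization.Cruxes.FiveFoldRation.IdeatorTwoSketch

end
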